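/-
search for candidate a priori estimates; no regularity claim

# K81a — DIRECTOR-CELL CALCULUS of a locally frozen strain eigenvector; exit and cap lemmas

Node of record (verbatim, unchanged): L-λ(q) =
`Summit.NavierStokesRegularity.FunctionalMining.TopEigHeatCoercivePos q := ∃ c > 0,`
`TopEigHeatCoercive q c` — OPEN for every real `q > 1`; (F2) killing family WANTED/OPEN. This
file decides NOTHING about the node: it is the general-dimension TOOLKIT of K81b (R27) "no
director cell" (`NoGo.TopEigHeatNoDirectorCell`), kept separate so that it builds AT ONCE on
built imports (no heat, no `q`, no eigenvalue selection enters here).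
§ 1 DIRECTOR-CELL CALCULUS (any `d`, pure torus calculus). Hypothesis: a CONSTANT vector
`c` and a constant `m` with `S(v)(y) c = m c` for all `y` near `z` (a locally frozen
eigenvector of the strain `S(v) = sym ∇v` of a smooth field `v : T^d → ℝ^d`). Conclusions at
`z`: VECTOR LAW `S(∂ₖv)(z) c = 0` (differentiate the eventually-constant `S c`);
LONGITUDINAL LAW `∂_c∂_c v (z) = Σⱼₖ cⱼcₖ ∂ⱼ∂ₖv (z) = 0` (the vector law weighted by `cₖ`:
the symmetric half is `∂ᵢ` of the longitudinal form `Σ cₖcⱼ(∂ₖv)ⱼ = cᵀS c = m|c|²`,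
a constant); HESSIAN LAW `Σⱼₖ cⱼcₖ S(∂ⱼ∂ₖv)(z) = 0` (differentiate the longitudinal law, which
holds near `z`). § 2 TWO REAL-LINE LEMMAS: EXIT — an open `A ∋ 0`, `I` its component of `0`,
a bounded `g` with `g′ = m > 0` on `I`: then `T = sup I` is finite, positive, `[0,T) ⊆ I`,
`T ∉ A`; CAP — `f ≥ L = f(T)`, `f′ = h`, `h′ = 0` on `[0,T)`: then `f(0) = L` (Fermat at `T`,
zero right-derivative ⇒ constant, twice).
HONEST PLACEMENT: § 1 is the first-order calculus of a frozen eigenvector (three derivatives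
of smooth functions, `Torus.partialDeriv` API of the Literature torus files); § 2 is
one-variable calculus (Mathlib `constant_of_has_deriv_right_zero`,
`IsLocalMin.hasDerivAt_eq_zero`, `connectedComponentIn`). No number of record moves. [ours;
§ 0 and § 2 folklore]
FILING (prove seat g33, REQUEST #111 v2): declarations byte-identical to the no-go seat's staged `TopEigDirectorCellCalculus.STAGING.lean` 7c3629a744092e08 (v2 per LEAD (59t)); this line is the only addition.
-/
import Summits.NavierStokesRegularity.FunctionalMining.TopEigDensityIdentity
import HarnessLib

noncomputable section

open Filter Topology Set Matrix Finset

namespace Summit.NavierStokesRegularity.FunctionalMining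

open Literature.Analysis Literature.Analysis.FunctionSpaces Literature.Analysis.FunctionSpaces.Torus

namespace TopEig.NoCell

/-! ## 0. Tools -/

section Tools

variable {d : Type*} [Fintype d]

/-- Finite sums of smooth torus functions are smooth. [folklore; TWIN of
`Literature.Analysis.FluidPDE.CompressibleEuler.isSmooth_fun_sum` — outside this file's import cone;
flagged for a later merge] -/
theorem isSmooth_fun_sum {ι F : Type*} [NormedAddCommGroup F] [NormedSpace ℝ F] (s : Finset ι)
    {f : ι → UnitAddTorus d → F} (h : ∀ i, Torus.IsSmooth (f i)) :
    Torus.IsSmooth fun y => ∑ i ∈ s, f i y := by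
  show ContDiff ℝ _ fun w => ∑ i ∈ s, f i (proj w)
  exact ContDiff.sum fun i _ => h i

variable [DecidableEq d]

/-- A function that is eventually constant near `z` has vanishing partial derivatives at `z`.
[folklore; cf. `TopEig.partialDeriv_eq_zero_of_eventuallyEq` (`TopEigGapCutoffSmooth`, constant `0`,
outside this import cone) — here any constant, no smoothness hypothesis; twin flagged] -/
theorem partialDeriv_eq_zero_of_eventually_eq {F : Type*} [NormedAddCommGroup F]
    [NormedSpace ℝ F] {f : UnitAddTorus d → F} {z : UnitAddTorus d} {a : F}
    (h : ∀ᶠ y in 𝓝 z, f y = a) (k : d) : Torus.partialDeriv k f z = 0 := by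
  have hc : Tendsto (fun t : ℝ => z + proj (t • EuclideanSpace.single k (1 : ℝ))) (𝓝 0)
      (𝓝 z) := by
    have hcont : Continuous fun t : ℝ => z + proj (t • EuclideanSpace.single k (1 : ℝ)) :=
      continuous_const.add (continuous_proj.comp (continuous_id.smul continuous_const))
    simpa only [zero_smul, proj_zero, add_zero] using hcont.tendsto 0
  have he : (fun t : ℝ => f (z + proj (t • EuclideanSpace.single k (1 : ℝ)))) =ᶠ[𝓝 0]
      fun _ => a := hc.eventually h
  show deriv (fun t : ℝ => f (z + proj (t • EuclideanSpace.single k (1 : ℝ)))) 0 = 0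
  rw [he.deriv_eq, deriv_const]

/-- A four-fold finite sum with the two outer indices moved inside. [folklore; homonyms over other
index shapes exist in `Literature/*`, none in this cone] -/
theorem sum_sum_sum_sum_comm {ι κ : Type*} [Fintype ι] [Fintype κ] (G : ι → ι → κ → κ → ℝ) :
    ∑ k, ∑ j, ∑ a, ∑ b, G k j a b = ∑ a, ∑ b, ∑ k, ∑ j, G k j a b := by
  calc ∑ k, ∑ j, ∑ a, ∑ b, G k j a b = ∑ k, ∑ a, ∑ j, ∑ b, G k j a b :=
        Finset.sum_congr rfl fun k _ => Finset.sum_comm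
    _ = ∑ a, ∑ k, ∑ j, ∑ b, G k j a b := Finset.sum_comm
    _ = ∑ a, ∑ k, ∑ b, ∑ j, G k j a b :=
        Finset.sum_congr rfl fun a _ => Finset.sum_congr rfl fun k _ => Finset.sum_comm
    _ = ∑ a, ∑ b, ∑ k, ∑ j, G k j a b := Finset.sum_congr rfl fun a _ => Finset.sum_comm

variable {v : UnitAddTorus d → EuclideanSpace ℝ d} {c : d → ℝ} {m : ℝ} {y z : UnitAddTorus d}

/-- `cᵀS(v)(y)c = m|c|²` when `S(v)(y) c = m c`. [bookkeeping] -/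
theorem sum_sum_strain_eq (h : torusStrainMatrix v y *ᵥ c = m • c) :
    ∑ i, ∑ j, c i * c j * torusStrainMatrix v y i j = m * (c ⬝ᵥ c) := by
  have h1 : ∀ i, ∑ j, torusStrainMatrix v y i j * c j = m * c i := fun i => by
    have e := congr_fun h i
    simpa only [mulVec, dotProduct, Pi.smul_apply, smul_eq_mul] using e
  simp only [dotProduct, Finset.mul_sum]
  refine Finset.sum_congr rfl fun i _ => ?_
  rw [show m * (c i * c i) = c i * (m * c i) by ring, ← h1 i, Finset.mul_sum]
  exact Finset.sum_congr rfl fun j _ => by ring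

/-- The longitudinal form `Σₖⱼ cₖcⱼ (∂ₖv)ⱼ(y) = cᵀS(v)(y)c = m|c|²` when `S(v)(y) c = m c`.
[bookkeeping] -/
theorem sum_sum_partialDeriv_eq (h : torusStrainMatrix v y *ᵥ c = m • c) :
    ∑ k, ∑ j, c k * c j * Torus.partialDeriv k v y j = m * (c ⬝ᵥ c) := by
  rw [← sum_sum_strain_eq h]
  have e := BiaxialEikonal.sum_partialDeriv_eq_sum_strain v y (WithLp.toLp 2 c)
  rw [← e, Finset.sum_comm]
  exact Finset.sum_congr rfl fun a _ => Finset.sum_congr rfl fun b _ => by ring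

/-- `y ↦ a·S(v)(y)ᵢⱼ` is smooth. [bookkeeping] -/
theorem isSmooth_const_mul_strainEntry (hv : Torus.IsSmooth v) (a : ℝ) (i j : d) :
    Torus.IsSmooth fun y => a * torusStrainMatrix v y i j :=
  (Torus.isSmooth_const a).smul' (isSmooth_torusStrainMatrix_entry hv i j)

end Tools

/-! ## 1. The director-cell calculus of a frozen top vector (any dimension) -/

section Cell

variable {d : Type*} [Fintype d] [DecidableEq d]
variable {v : UnitAddTorus d → EuclideanSpace ℝ d} {c : d → ℝ} {m : ℝ} {z : UnitAddTorus d}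

/-- **VECTOR LAW of a frozen top vector.** If `S(v)(y) c = m c` for all `y` near `z` (constant
vector `c`, constant `m`), then `S(∂ₖv)(z) c = 0` for every `k`. [ours] -/
theorem strainDeriv_mulVec_eq_zero (hv : Torus.IsSmooth v)
    (h : ∀ᶠ y in 𝓝 z, torusStrainMatrix v y *ᵥ c = m • c) (k : d) :
    torusStrainMatrix (Torus.partialDeriv k v) z *ᵥ c = 0 := by
  ext i
  have hF : ∀ᶠ y in 𝓝 z, ∑ j, c j * torusStrainMatrix v y i j = m * c i := by
    filter_upwards [h] with y hy
    have hi := congr_fun hy i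
    simp only [mulVec, dotProduct, Pi.smul_apply, smul_eq_mul] at hi
    rw [← hi]
    exact Finset.sum_congr rfl fun j _ => mul_comm _ _
  have h0 := partialDeriv_eq_zero_of_eventually_eq hF k
  rw [partialDeriv_finset_sum _
    (fun j _ => (isSmooth_const_mul_strainEntry hv (c j) i j).isContDiff (by simp)) k z] at h0
  simp only [mulVec, dotProduct, Pi.zero_apply]
  refine (Finset.sum_congr rfl fun j _ => ?_).trans h0
  rw [partialDeriv_const_mul, partialDeriv_strainEntry hv k i j z, mul_comm]

/-- **LONGITUDINAL LAW**: under the same hypothesis `∂_c∂_c v (z) = 0`, i.e.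
`Σₖⱼ cₖcⱼ (∂ⱼ∂ₖv)ᵢ(z) = 0` for every `i`. [ours] -/
theorem sum_sum_partialDeriv_partialDeriv_eq_zero (hv : Torus.IsSmooth v)
    (h : ∀ᶠ y in 𝓝 z, torusStrainMatrix v y *ᵥ c = m • c) (i : d) :
    ∑ k, ∑ j, c k * c j * Torus.partialDeriv j (Torus.partialDeriv k v) z i = 0 := by
  -- (i) the vector law at `z`, component `i`, weighted by `cₖ` and summed over `k`
  have hvl : ∑ k, ∑ j, c k * c j * Torus.partialDeriv j (Torus.partialDeriv k v) z i +
      ∑ k, ∑ j, c k * c j * Torus.partialDeriv i (Torus.partialDeriv k v) z j = 0 := by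
    rw [← Finset.sum_add_distrib]
    refine Finset.sum_eq_zero fun k _ => ?_
    rw [← Finset.sum_add_distrib]
    have e := congr_arg (fun r => 2 * c k * r) (congr_fun (strainDeriv_mulVec_eq_zero hv h k) i)
    simp only [mulVec, dotProduct, torusStrainMatrix, of_apply, Pi.zero_apply, mul_zero,
      Finset.mul_sum] at e
    rw [← e]
    exact Finset.sum_congr rfl fun j _ => by ring
  -- (ii) the second sum is `∂ᵢ` of the longitudinal form, which is eventually constant
  have hQ : ∀ᶠ y in 𝓝 z, ∑ k, ∑ j, c k * c j * Torus.partialDeriv k v y j = m * (c ⬝ᵥ c) := by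
    filter_upwards [h] with y hy using sum_sum_partialDeriv_eq hy
  have hQ0 := partialDeriv_eq_zero_of_eventually_eq hQ i
  have hsm : ∀ k j, Torus.IsSmooth fun y => c k * c j * Torus.partialDeriv k v y j := fun k j =>
    (Torus.isSmooth_const _).smul' ((hv.partialDeriv k).apply j)
  have hin : ∀ k, Torus.partialDeriv i (fun y => ∑ j, c k * c j * Torus.partialDeriv k v y j) z =
      ∑ j, c k * c j * Torus.partialDeriv i (Torus.partialDeriv k v) z j := fun k => by
    rw [partialDeriv_finset_sum _ (fun j _ => (hsm k j).isContDiff (by simp)) i z]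
    refine Finset.sum_congr rfl fun j _ => ?_
    rw [partialDeriv_const_mul, partialDeriv_apply_coord ((hv.partialDeriv k).isContDiff (by simp))]
  rw [partialDeriv_finset_sum _
    (fun k _ => (isSmooth_fun_sum _ (hsm k)).isContDiff (by simp)) i z] at hQ0
  simp only [hin] at hQ0
  linarith

/-- **HESSIAN LAW**: under the same hypothesis `Σₖⱼ cₖcⱼ S(∂ⱼ∂ₖv)(z) = 0` (entrywise). [ours] -/
theorem sum_sum_strain_partialDeriv_partialDeriv_eq_zero (hv : Torus.IsSmooth v)
    (h : ∀ᶠ y in 𝓝 z, torusStrainMatrix v y *ᵥ c = m • c) (a b : d) :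
    ∑ k, ∑ j, c k * c j *
      torusStrainMatrix (Torus.partialDeriv j (Torus.partialDeriv k v)) z a b = 0 := by
  -- the longitudinal law holds near `z`; differentiate it
  have hD : ∀ a b, ∑ k, ∑ j, c k * c j *
      Torus.partialDeriv a (Torus.partialDeriv j (Torus.partialDeriv k v)) z b = 0 := fun a b => by
    have h2 : ∀ᶠ y in 𝓝 z,
        ∑ k, ∑ j, c k * c j * Torus.partialDeriv j (Torus.partialDeriv k v) y b = 0 := by
      filter_upwards [h.eventually_nhds] with y hy
      exact sum_sum_partialDeriv_partialDeriv_eq_zero hv hy b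
    have h0 := partialDeriv_eq_zero_of_eventually_eq h2 a
    have hsm : ∀ k j,
        Torus.IsSmooth fun y => c k * c j * Torus.partialDeriv j (Torus.partialDeriv k v) y b :=
      fun k j => (Torus.isSmooth_const _).smul' (((hv.partialDeriv k).partialDeriv j).apply b)
    have hin : ∀ k, Torus.partialDeriv a
        (fun y => ∑ j, c k * c j * Torus.partialDeriv j (Torus.partialDeriv k v) y b) z =
        ∑ j, c k * c j * Torus.partialDeriv a (Torus.partialDeriv j (Torus.partialDeriv k v)) z b :=
      fun k => by
      rw [partialDeriv_finset_sum _ (fun j _ => (hsm k j).isContDiff (by simp)) a z]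
      refine Finset.sum_congr rfl fun j _ => ?_
      rw [partialDeriv_const_mul,
        partialDeriv_apply_coord (((hv.partialDeriv k).partialDeriv j).isContDiff (by simp))]
    rw [partialDeriv_finset_sum _
      (fun k _ => (isSmooth_fun_sum _ (hsm k)).isContDiff (by simp)) a z] at h0
    simpa only [hin] using h0
  have e : ∀ k j,
      c k * c j * torusStrainMatrix (Torus.partialDeriv j (Torus.partialDeriv k v)) z a b =
      (c k * c j * Torus.partialDeriv b (Torus.partialDeriv j (Torus.partialDeriv k v)) z a +
        c k * c j * Torus.partialDeriv a (Torus.partialDeriv j (Torus.partialDeriv k v)) z b) / 2 :=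
    fun k j => by simp only [torusStrainMatrix, of_apply]; ring
  simp_rw [e, ← Finset.sum_div, Finset.sum_add_distrib, hD, add_zero, zero_div]

end Cell

/-! ## 2. Exit and cap on the real line -/

section RealLine

/-- **EXIT LEMMA.** Let `A ⊆ ℝ` be open, `0 ∈ A`, `I` the connected component of `0` in `A`.
If a bounded `g` has derivative `m > 0` at every point of `I`, then `I` is bounded above and
`T = sup I > 0` has `[0, T) ⊆ I`, `T ∉ A`. [folklore] -/
theorem exists_exit {A : Set ℝ} (hA : IsOpen A) (h0 : (0 : ℝ) ∈ A) {g : ℝ → ℝ} {m B : ℝ}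
    (hm : 0 < m) (hB : ∀ t, |g t| ≤ B)
    (hg : ∀ t ∈ connectedComponentIn A 0, HasDerivAt g m t) :
    ∃ T : ℝ, 0 < T ∧ Set.Ico 0 T ⊆ connectedComponentIn A 0 ∧ T ∉ A := by
  set I := connectedComponentIn A 0 with hI
  have hIo : IsOpen I := hA.connectedComponentIn
  have h0I : (0 : ℝ) ∈ I := mem_connectedComponentIn h0
  have hIA : I ⊆ A := connectedComponentIn_subset A 0
  have hoc : OrdConnected I := isPreconnected_iff_ordConnected.1 isPreconnected_connectedComponentIn
  -- linear growth of `g` on `[0, t] ⊆ I`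
  have hlin : ∀ t, 0 ≤ t → Set.Icc 0 t ⊆ I → g t = g 0 + m * t := by
    intro t ht hsub
    have hc : ContinuousOn (fun s => g s - m * s) (Set.Icc 0 t) := fun s hs =>
      ((hg s (hsub hs)).continuousAt.sub
        (continuous_const.mul continuous_id).continuousAt).continuousWithinAt
    have hd : ∀ s ∈ Set.Ico 0 t, HasDerivWithinAt (fun s => g s - m * s) 0 (Set.Ici s) s :=
      fun s hs => (((hg s (hsub (Set.Ico_subset_Icc_self hs))).sub
        ((hasDerivAt_id' s).const_mul m)).congr_deriv (by ring)).hasDerivWithinAt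
    have e := constant_of_has_deriv_right_zero hc hd t (Set.right_mem_Icc.2 ht)
    simp only [mul_zero, sub_zero] at e
    linarith
  -- `I` is bounded above
  have hB0 : 0 ≤ B := (abs_nonneg _).trans (hB 0)
  have hbdd : BddAbove I := by
    by_contra hnb
    obtain ⟨s, hsI, hts⟩ := not_bddAbove_iff.1 hnb ((2 * B + 1) / m)
    have ht0 : 0 ≤ (2 * B + 1) / m := by positivity
    have e := hlin _ ht0 ((Set.Icc_subset_Icc_right hts.le).trans (hoc.out h0I hsI))
    have e2 : m * ((2 * B + 1) / m) = 2 * B + 1 := by field_simp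
    have h1 := abs_le.1 (hB ((2 * B + 1) / m))
    have h2 := abs_le.1 (hB 0)
    linarith [h1.2, h2.1]
  -- the exit time `T = sup I`
  set T := sSup I with hT
  have hT0 : 0 < T := by
    obtain ⟨ε, hε, hball⟩ := Metric.isOpen_iff.1 hIo 0 h0I
    rw [Real.ball_eq_Ioo, zero_sub, zero_add] at hball
    exact (half_pos hε).trans_le (le_csSup hbdd (hball ⟨by linarith, by linarith⟩))
  have hIco : Set.Ico 0 T ⊆ I := fun t ht => by
    obtain ⟨s, hsI, hts⟩ := exists_lt_of_lt_csSup ⟨0, h0I⟩ ht.2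
    exact hoc.out h0I hsI ⟨ht.1, hts.le⟩
  refine ⟨T, hT0, hIco, fun hTA => ?_⟩
  obtain ⟨ε, hε, hball⟩ := Metric.isOpen_iff.1 hA T hTA
  rw [Real.ball_eq_Ioo] at hball
  obtain ⟨s, hsI, hs⟩ := exists_lt_of_lt_csSup ⟨0, h0I⟩ (show T - ε < T by linarith)
  have hsT : s ≤ T := le_csSup hbdd hsI
  have hJ : IsPreconnected (I ∪ Set.Ioo (T - ε) (T + ε)) :=
    IsPreconnected.union s hsI ⟨hs, by linarith⟩ isPreconnected_connectedComponentIn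
      isPreconnected_Ioo
  have hmem : T + ε / 2 ∈ I :=
    hJ.subset_connectedComponentIn (Or.inl h0I) (union_subset hIA hball)
      (Or.inr ⟨by linarith, by linarith⟩)
  linarith [le_csSup hbdd hmem]

/-- **CAP LEMMA.** If `f ≥ L` on `ℝ` with `f T = L`, `f′ = h`, `h′ = k` and `k = 0` on
`[0, T)` (`T ≥ 0`), then `f 0 = L`: Fermat gives `h T = 0`, so `h ≡ 0` and `f` is constant
on `[0, T]`. [folklore] -/
theorem eq_of_min_of_deriv_deriv_eq_zero {f h k : ℝ → ℝ} {L T : ℝ} (hT : 0 ≤ T)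
    (hf : ∀ t, HasDerivAt f (h t) t) (hh : ∀ t, HasDerivAt h (k t) t)
    (hk : ∀ t ∈ Set.Ico 0 T, k t = 0) (hL : ∀ t, L ≤ f t) (hfT : f T = L) : f 0 = L := by
  have hmin : IsLocalMin f T := Filter.Eventually.of_forall fun t => by rw [hfT]; exact hL t
  have hhT : h T = 0 := hmin.hasDerivAt_eq_zero (hf T)
  have hconst : ∀ t ∈ Set.Icc 0 T, h t = h 0 :=
    constant_of_has_deriv_right_zero (fun t _ => (hh t).continuousAt.continuousWithinAt)
      fun t ht => ((hh t).congr_deriv (hk t ht)).hasDerivWithinAt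
  have hh0 : ∀ t ∈ Set.Ico 0 T, h t = 0 := fun t ht => by
    rw [hconst t (Set.Ico_subset_Icc_self ht), ← hconst T (Set.right_mem_Icc.2 hT), hhT]
  have e := constant_of_has_deriv_right_zero (f := f)
    (fun t _ => (hf t).continuousAt.continuousWithinAt)
    (fun t ht => ((hf t).congr_deriv (hh0 t ht)).hasDerivWithinAt) T (Set.right_mem_Icc.2 hT)
  rw [← e, hfT]

end RealLine

end TopEig.NoCell

end Summit.NavierStokesRegularity.FunctionalMining

end
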